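import Summits.HodgeConjecture.CorCM.GaloisDegenerateExtension
import Summits.HodgeConjecture.CorCM.GaloisDegenerateQuadraticSplit
import HarnessLib

/-!
# A linearly disjoint factor never rescues a BAD field: `K = K₀ · L` with `K₀` Galois CM BAD, `K₀`, `L` linearly disjoint ⟹
# `K` is BAD (`[L : ℚ] ≥ 3` always; `[L : ℚ] = 2` for `L` totally real)

COR-CM (cell `pub-hodgecm2`), binder seat b04 (gen 31), count-neutral own lane «Galois-CM-type classification»; the
COMPOSITUM packaging of gen 31's monotonicity theorems (`CorCM/GaloisDegenerateExtension.exists_simple_degenerate_of_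
intermediateField` for `[K:K₀] ≥ 3`, which needs no complement at all, and `CorCM/GaloisDegenerateQuadraticSplit.exists_
simple_degenerate_of_subfield_complement_two_all` for `[K:K₀] = 2`, which needs the totally real complement `L`).
KERNEL ONLY: theorems; no definition, no named fact, no `sorry`.  `HC_CM` is neither used nor claimed.

SETTING.  `K` a Galois CM field; `K₀, L ⊆ K` intermediate fields with `K₀` Galois CM, `L` fixed by complex conjugation (totally
real), `K₀ ⊔ L = K` and `[K₀:ℚ]·[L:ℚ] = [K:ℚ]` (`K₀`, `L` linearly disjoint).  Then (`fixingSubgroup_complement`) `Γ = Gal(K/L)`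
contains complex conjugation, meets `Gal(K/K₀)` trivially (an automorphism fixing `K₀` and `L` fixes `K₀ ⊔ L = K`:
`algEquiv_eq_one_of_mem_fixingSubgroup_of_sup_eq_top`, Galois correspondence `IntermediateField.le_iff_le`), has order
`[K:L] = [K₀:ℚ]`, and `[K:K₀] = [L:ℚ]` — so `Gal(K/ℚ) = Gal(K/K₀) ⋊ Gal(K/L)`.  `L` need NOT be Galois over `ℚ`.

THEOREMS.  If `K₀` has a PRIMITIVE DEGENERATE CM type, then `K` carries a SIMPLE DEGENERATE abelian variety of dimension
`[K:ℚ]/2` with CM by `K` (a rational `(p,p)` class outside the divisor ring on some power):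
* **`exists_simple_degenerate_of_compositum_degree_ge_three`** — when `[L:ℚ] ≥ 3` (here only `[K:K₀] = [L:ℚ] ≥ 3` is used and
  `L` need not be totally real: `CorCM/GaloisDegenerateExtension` covers EVERY Galois CM extension of degree `≥ 3`);
* **`exists_simple_degenerate_of_compositum_realQuadratic`** — when `[L:ℚ] = 2` and `L` is totally real (the complement
  `Gal(K/L)` must contain complex conjugation; `CorCM/GaloisDegenerateQuadraticSplit`, no hypothesis on `Gal(K₀/ℚ)`);
* **`exists_simple_degenerate_of_compositum`** — both at once: `L` totally real, `[L:ℚ] ≥ 2`.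
In the language of the classification: **BAD(K₀) ⟹ BAD(K₀ L)** for every totally real `L ≠ ℚ` linearly disjoint from `K₀`,
equivalently **GOOD(K₀ L) ⟹ GOOD(K₀)** — if the Hodge rings of all powers of all simple CM abelian varieties with CM by `K₀ L`
are generated by divisor classes (`B = D`), then so are those with CM by `K₀` (BAD = an exceptional Hodge class on some power,
whose algebraicity stays open).  (For `[L:ℚ] ≥ 3` linear disjointness and reality are not even needed:
`CorCM/GaloisDegenerateExtension`.)  What is NOT settled: quadratic extensions `K ⊇ K₀` that do not split through complex
conjugation.  That GOOD is NOT preserved upwards is the content of gens 19–30 (`Q₈` GOOD but `Q₈ × C₃`, `Q₈ × C₂²` BAD; `D₈(16)`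
GOOD but `D₈(16) × C₂` BAD).

## References

* [Kubota1965] T. Kubota, *On the field extension by complex multiplication*, Trans. AMS 118 (1965), §2, §4 Lemma 2.
* [Shimura1998] G. Shimura, *Abelian Varieties with Complex Multiplication and Modular Functions*, §6.2 Thm. 3, §8.2 Prop. 26.
* [Gordon1999HodgeAVSurvey] B. B. Gordon, *A survey of the Hodge conjecture for abelian varieties*, Thm. 6.4, §9.3.
-/

noncomputable section

open CategoryTheory CategoryTheory.Limits NumberField
open scoped BigOperators

namespace Summit.HodgeConjecture.CorCM.GaloisModels

open Literature.NumberTheory.ComplexMultiplication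
open Literature.AlgebraicGeometry.Motives (AbelianVariety CMType)
open Literature.AlgebraicGeometry.HodgeTheory
open Literature.AlgebraicGeometry.ComplexMultiplication (IsCMTypeRealisation)
open Literature.AlgebraicGeometry.Pohlmann1968
open Literature.Barriers.HodgeConjecture (divisorClassesSpan)

variable {K : Type} [Field K] [NumberField K] [IsCMField K] [IsGalois ℚ K]

/-! ## §1 The complement `Gal(K/L)` -/

omit [IsCMField K] [IsGalois ℚ K] in
/-- An automorphism of `K` fixing two intermediate fields that generate `K` is the identity (Galois correspondence).
[folklore] -/
theorem algEquiv_eq_one_of_mem_fixingSubgroup_of_sup_eq_top (K₀ L : IntermediateField ℚ K) (hsup : K₀ ⊔ L = ⊤)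
    {g : K ≃ₐ[ℚ] K} (hK₀ : g ∈ K₀.fixingSubgroup) (hL : g ∈ L.fixingSubgroup) : g = 1 := by
  have h1 : K₀ ≤ IntermediateField.fixedField (Subgroup.zpowers g) :=
    (IntermediateField.le_iff_le _ _).2 ((Subgroup.zpowers_le).2 hK₀)
  have h2 : L ≤ IntermediateField.fixedField (Subgroup.zpowers g) :=
    (IntermediateField.le_iff_le _ _).2 ((Subgroup.zpowers_le).2 hL)
  have h3 : (⊤ : IntermediateField ℚ K) ≤ IntermediateField.fixedField (Subgroup.zpowers g) := by
    rw [← hsup]; exact sup_le h1 h2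
  have h4 := (IntermediateField.le_iff_le _ _).1 h3
  rw [IntermediateField.fixingSubgroup_top, le_bot_iff, Subgroup.zpowers_eq_bot] at h4
  exact h4

omit [IsCMField K] in
/-- **`Gal(K/L)` is a complement of `Gal(K/K₀)`** when `K₀ ⊔ L = K` and `[K₀:ℚ]·[L:ℚ] = [K:ℚ]` (`K₀` normal): it meets
`Gal(K/K₀)` trivially, `|Gal(K/L)| = [K₀:ℚ]` and `[K:K₀] = [L:ℚ]`. [folklore] -/
theorem fixingSubgroup_complement (K₀ L : IntermediateField ℚ K) [IsGalois ℚ K₀] (hsup : K₀ ⊔ L = ⊤)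
    (hcard : Module.finrank ℚ K₀ * Module.finrank ℚ L = Module.finrank ℚ K) :
    (∀ g ∈ L.fixingSubgroup, AlgEquiv.restrictNormalHom K₀ g = 1 → g = 1) ∧
      Nat.card L.fixingSubgroup = Module.finrank ℚ K₀ ∧ Module.finrank K₀ K = Module.finrank ℚ L := by
  have hL' : Module.finrank ℚ L * Module.finrank L K = Module.finrank ℚ K := Module.finrank_mul_finrank ℚ L K
  have hK₀' : Module.finrank ℚ K₀ * Module.finrank K₀ K = Module.finrank ℚ K := Module.finrank_mul_finrank ℚ K₀ K
  have hposL : 0 < Module.finrank ℚ L := Module.finrank_pos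
  have hposK₀ : 0 < Module.finrank ℚ K₀ := Module.finrank_pos
  refine ⟨fun g hg hres => ?_, ?_, ?_⟩
  · refine algEquiv_eq_one_of_mem_fixingSubgroup_of_sup_eq_top K₀ L hsup ?_ hg
    rw [IntermediateField.mem_fixingSubgroup_iff]
    intro x hx
    exact apply_algebraMap_of_restrictNormalHom_eq_one K₀ hres ⟨x, hx⟩
  · rw [IsGalois.card_fixingSubgroup_eq_finrank]
    apply Nat.eq_of_mul_eq_mul_left hposL
    rw [hL', ← hcard, mul_comm]
  · apply Nat.eq_of_mul_eq_mul_left hposK₀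
    rw [hK₀', ← hcard]

/-! ## §2 The theorems -/

/-- **A LINEARLY DISJOINT FACTOR OF DEGREE `≥ 3` NEVER RESCUES A BAD FIELD.**  `K` Galois CM; `K₀, L ⊆ K` with `K₀` Galois
CM, `K₀ ⊔ L = K`, `[K₀:ℚ]·[L:ℚ] = [K:ℚ]`, `[L:ℚ] ≥ 3` (`L` need not be totally real: only `[K:K₀] = [L:ℚ] ≥ 3` matters);
`K₀` has a primitive DEGENERATE CM type ⟹ `K` carries a SIMPLE DEGENERATE abelian variety of dimension `[K:ℚ]/2` with CM by
`K` (a rational `(p,p)` class outside the divisor ring on some power). [cite: Kubota1965, §2 and §4 Lemma 2]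
[cite: Shimura1998, §6.2 Thm. 3 and §8.2 Prop. 26] [cite: Gordon1999HodgeAVSurvey, Thm. 6.4 and §9.3] -/
theorem exists_simple_degenerate_of_compositum_degree_ge_three (K₀ L : IntermediateField ℚ K) [IsCMField K₀] [IsGalois ℚ K₀]
    (hsup : K₀ ⊔ L = ⊤) (hcard : Module.finrank ℚ K₀ * Module.finrank ℚ L = Module.finrank ℚ K)
    (hdeg : 3 ≤ Module.finrank ℚ L)
    (Φ₀ : CMType K₀) (φ₀ : K₀ →+* ℂ) (hprim : IsPrimitive (ℂ ≃+* ℂ) Φ₀.1 φ₀) (hndg : ¬ IsNondegenerate Φ₀) :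
    ∃ (Φ : CMType K) (φ : K →+* ℂ) (X : AbelianVariety ℂ) (ι : 𝓞 K →+* End X)
      (ϑ : K →+* Module.End ℂ (complexBetti X.X 1)),
      IsPrimitive (ℂ ≃+* ℂ) Φ.1 φ ∧ ¬ IsNondegenerate Φ ∧ IsCMTypeRealisation Φ X ι ϑ ∧ X.IsSimple ∧
      X.dim = Module.finrank ℚ K / 2 ∧
      ∃ m p : ℕ, ∃ y : complexBetti (⨁ fun _ : Fin m => X).X (2 * p), IsRationalClass y ∧
        IsOfHodgeType (⨁ fun _ : Fin m => X).dim (⨁ fun _ : Fin m => X).X (2 * p) p p y ∧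
        y ∉ divisorClassesSpan (⨁ fun _ : Fin m => X).X (⨁ fun _ : Fin m => X).dim p := by
  obtain ⟨-, -, hK₀K⟩ := fixingSubgroup_complement K₀ L hsup hcard
  exact exists_simple_degenerate_of_intermediateField K₀ (by omega) Φ₀ φ₀ hprim hndg

/-- **A REAL QUADRATIC FACTOR NEVER RESCUES A BAD FIELD.**  As above with `L` fixed by complex conjugation and `[L:ℚ] = 2`
(no hypothesis on `Gal(K₀/ℚ)`: the exponent-two case is the abelian classification, `CorCM/GaloisDegenerateQuadraticSplit`).
[cite: Kubota1965, §2 and §4 Lemma 2] [cite: Shimura1998, §6.2 Thm. 3 and §8.2 Prop. 26] [cite: Gordon1999HodgeAVSurvey, Thm. 6.4 and §9.3] -/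
theorem exists_simple_degenerate_of_compositum_realQuadratic (K₀ L : IntermediateField ℚ K) [IsCMField K₀] [IsGalois ℚ K₀]
    (hL : ∀ x ∈ L, IsCMField.complexConj K x = x) (hsup : K₀ ⊔ L = ⊤)
    (hcard : Module.finrank ℚ K₀ * Module.finrank ℚ L = Module.finrank ℚ K) (hdeg : Module.finrank ℚ L = 2)
    (Φ₀ : CMType K₀) (φ₀ : K₀ →+* ℂ) (hprim : IsPrimitive (ℂ ≃+* ℂ) Φ₀.1 φ₀) (hndg : ¬ IsNondegenerate Φ₀) :
    ∃ (Φ : CMType K) (φ : K →+* ℂ) (X : AbelianVariety ℂ) (ι : 𝓞 K →+* End X)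
      (ϑ : K →+* Module.End ℂ (complexBetti X.X 1)),
      IsPrimitive (ℂ ≃+* ℂ) Φ.1 φ ∧ ¬ IsNondegenerate Φ ∧ IsCMTypeRealisation Φ X ι ϑ ∧ X.IsSimple ∧
      X.dim = Module.finrank ℚ K / 2 ∧
      ∃ m p : ℕ, ∃ y : complexBetti (⨁ fun _ : Fin m => X).X (2 * p), IsRationalClass y ∧
        IsOfHodgeType (⨁ fun _ : Fin m => X).dim (⨁ fun _ : Fin m => X).X (2 * p) p p y ∧
        y ∉ divisorClassesSpan (⨁ fun _ : Fin m => X).X (⨁ fun _ : Fin m => X).dim p := by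
  obtain ⟨hdisj, hΓ, hK₀K⟩ := fixingSubgroup_complement K₀ L hsup hcard
  refine exists_simple_degenerate_of_subfield_complement_two_all K₀ L.fixingSubgroup ?_ hdisj hΓ (by omega) Φ₀ φ₀ hprim
    hndg
  rw [IntermediateField.mem_fixingSubgroup_iff]
  exact fun x hx => hL x hx

/-- **BAD(K₀) ⟹ BAD(K₀ L) FOR EVERY LINEARLY DISJOINT TOTALLY REAL `L ≠ ℚ`** — unconditionally: `K` carries a simple
degenerate abelian variety of dimension `[K:ℚ]/2` with CM by `K`.  Equivalently: if the Hodge rings of all powers of all simple CM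
abelian varieties with CM by `K = K₀ L` are generated by divisor classes, then so are those with CM by `K₀`.
[cite: Kubota1965, §2 and §4 Lemma 2]
[cite: Shimura1998, §6.2 Thm. 3 and §8.2 Prop. 26] [cite: Gordon1999HodgeAVSurvey, Thm. 6.4 and §9.3] -/
theorem exists_simple_degenerate_of_compositum (K₀ L : IntermediateField ℚ K) [IsCMField K₀] [IsGalois ℚ K₀]
    (hL : ∀ x ∈ L, IsCMField.complexConj K x = x) (hsup : K₀ ⊔ L = ⊤)
    (hcard : Module.finrank ℚ K₀ * Module.finrank ℚ L = Module.finrank ℚ K) (hdeg : 2 ≤ Module.finrank ℚ L)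
    (Φ₀ : CMType K₀) (φ₀ : K₀ →+* ℂ) (hprim : IsPrimitive (ℂ ≃+* ℂ) Φ₀.1 φ₀) (hndg : ¬ IsNondegenerate Φ₀) :
    ∃ (Φ : CMType K) (φ : K →+* ℂ) (X : AbelianVariety ℂ) (ι : 𝓞 K →+* End X)
      (ϑ : K →+* Module.End ℂ (complexBetti X.X 1)),
      IsPrimitive (ℂ ≃+* ℂ) Φ.1 φ ∧ ¬ IsNondegenerate Φ ∧ IsCMTypeRealisation Φ X ι ϑ ∧ X.IsSimple ∧
      X.dim = Module.finrank ℚ K / 2 ∧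
      ∃ m p : ℕ, ∃ y : complexBetti (⨁ fun _ : Fin m => X).X (2 * p), IsRationalClass y ∧
        IsOfHodgeType (⨁ fun _ : Fin m => X).dim (⨁ fun _ : Fin m => X).X (2 * p) p p y ∧
        y ∉ divisorClassesSpan (⨁ fun _ : Fin m => X).X (⨁ fun _ : Fin m => X).dim p := by
  by_cases h2 : Module.finrank ℚ L = 2
  · exact exists_simple_degenerate_of_compositum_realQuadratic K₀ L hL hsup hcard h2 Φ₀ φ₀ hprim hndg
  · exact exists_simple_degenerate_of_compositum_degree_ge_three K₀ L hsup hcard (by omega) Φ₀ φ₀ hprim hndg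

end Summit.HodgeConjecture.CorCM.GaloisModels

end
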